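import Literature.MathematicalPhysics.QuantumFieldTheory.Balaban1983to89.B7Prop5Flat

/-!
# B7 Proposition 5 at a general background — file 1: the positive averaging operators `Q`, `Q″` of (139)–(140) on real
# bond functions and the KERNELS of `Q_j`, `Q″_j` (141), with the printed OPERATOR FACTS of pp. 39–40 kernel-proved in
# b07's `ℤᵈ` typing (`B7Prop5GeneralOperators`)

CITATION HEADER (lean-in-tree rule 2026-08-18).  Audit cell `pub-balaban`, sub-cell `t4`, NE7c ROUND-2 crew seat
`b2b-balaban-t4-ne7c-formalise-leaf-10` gen 10; owner table `t4/b2b-balaban-t4-ne7c-p1/LEAVES-NE7c-P1.md` row **S68 (c)**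
«[B7] Prop. 5 at a general regular background — the k-fold composition» (cut l.15650 accepted by the owner l.15880).
Source: T. Bałaban, *Averaging operations for lattice gauge theories*, Commun. Math. Phys. **98**, 17–51 (1985)
[Balaban1985Averaging] (cell paper B7; journal page = PDF page + 16), Sect. D pp. 39–40 [PDF 23–24], renders
`b2b-balaban-ref1/pages/1985-cmp98-averaging/1985-cmp98-averaging-p023-x2.png`, `-p024-x2.png` READ AS IMAGES by this seat
(2026-08-20).  Companions REUSED BY NAME, none restated: `B7Prop5Flat` (b07: `BondIn`, `S1 = bondsIn q (bondHi L q κ)` =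
the bonds of `B(c₋) ∪ B(c₊)`, `bump`, `blockPt`, `nearBonds`, `card_nearBonds_le`, `mem_nearBonds_of_bondIn`,
`eq_blockPt_or`, `card_line_hits_le`, `sum_le_card_mul_of_zero`, `bondIn_line`, `bondIn_pow_line`, `inBox_nest`),
`B7Prop4Flat` (`boxPair`, `boxVec_boxPair`, `linQ_eq_sum`, `linQIter_eq_linQ_pow`), `B7Prop1Local` (`InBox`, `loK`,
`bondHiK`, `bondHi`), `B7Prop1Explicit` (`Site = ℤᵈ`, `e`, `boxVec`), `B7Ineq148` (`Qpp` = (140) on a finite bond set).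

THE PRINTED TEXT (p. 39 [PDF 23], verbatim): «From (124) it is clear that we have the inequalities
|Q_{V₀}A| ≦ Q|A|, |Q″(V₀)A| ≦ C′₁L²α₀Q″|A|, (139) where the operator Q is defined as in [2], and Q″ is defined as
(Q″A)_c = Σ_{b⊂B(c₋)∪B(c₊)} L^{−d}A_b. (140) The constant C′₁ depends on d and L. A composition of k operators Q is the
operator Q_k. The operators Q″ do not compose in a simple way, but if we introduce an operator Q″_k by the formula
(Q″_kA)_c = Σ_{b⊂B^k(c₋)∪B^k(c₊)} η^dA_b, c ⊂ Ω^{(k)}, (141) then we have the inequality |Q″Q″_jA| ≦ Q″Q″_j|A| ≦ 2dQ″_{j+1}|A|.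
(142)»; p. 40 [PDF 24], after (144): «Further using the inequalities (142), QQ″_j|A| ≦ 2Q″_{j+1}|A|, and Q″Q_j|A| ≦ Q″_{j+1}|A|,
we get (145)»; p. 40, (146): «|Q_k(U₀)A| ≦ Q_k|A| + 2C′₁α₀Q″_k|A| ≦ (1 + 2C′₁α₀)Q″_k|A|».  [2] = B5, (1.11)/(1.18): the
straight-line block average `(Q_kA)_b = Σ_{x∈B^k(b₋)} η^{d+1} A([x, x(b)])`.

WHAT THIS FILE PROVIDES (kernel, 0 sorry), in b07's conventions (every lattice `Ω^{(j)}` identified with `ℤᵈ`, a bond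
`c ⊂ Ω^{(j)}` = `(z, κ)` read on the unit lattice as `⟨Lʲz, Lʲz + Lʲe_κ⟩`; a unit-lattice bond `b = ⟨y, y + e_μ⟩` = `(y, μ)`):
* §1 the ONE-STEP operators on REAL bond functions `g : Site d → Fin d → ℝ`: `avQ L g q κ = Σ_{r∈[0,L)ᵈ} L^{−d} Σ_{i<L}
  g(q + r + ie_κ, κ)` — `L·(Q g)_c` for `c = ⟨q, q + Le_κ⟩`, the un-normalised straight-line average (= the shape of
  `B7Prop4Flat.linQ_eq_sum`, print's `L·Q` since the linear part (122) is `L(Q(V₀)A)_c`) — and `ddQ L g q κ = L^{−d}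
  Σ_{b∈S1 L q κ} g_b` = (140); monotone, additive, homogeneous; `Qpp_restr_eq_ddQ` (pv23's `Qpp` on `𝔸^{S1}` IS `ddQ` of the
  pointwise norm).
* §2 the KERNEL COLUMNS of the composed operators at the unit-lattice bond `b = (y, μ)`: `kerQ L j z κ y μ` = the
  coefficient of `A_b` in the un-normalised `Lʲ`-block average at `⟨Lʲz, Lʲz+Lʲe_κ⟩` (`= L^{−jd}·#{segment positions equal
  to b}`; `linQIter_bump`: `B7Prop4Flat.linQIter L (bump y μ X) j z κ = kerQ • X`) and `kerQdd L j z κ y μ =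
  L^{−jd}·𝟙[b ⊂ Bʲ(c₋) ∪ Bʲ(c₊)]` = the column of (141); sizes `kerQ ≤ Lʲ·kerQdd` («Q_k|A| ≦ Q″_k|A|» per column, the
  step to (146)), `kerQdd ≤ L^{−jd}`, vanishing off the box.
* the PRINTED OPERATOR FACTS themselves («QQ_j = Q_{j+1}», «QQ″_j ≦ 2Q″_{j+1}», «Q″Q_j ≦ Q″_{j+1}», (142)) are
  kernel-proved on these columns in the sibling `B7Prop5GeneralOperatorFacts` (split for the 400-line rule).  The
  un-normalised currency carries one factor `L` per level in `avQ` and `Lʲ` in `kerQ` (`Q_j = L^{−j}·kerQ`), exactly as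
  `B7Prop4Flat.linQIter = LʲηQ_j(1)`.
Nothing of the paper's analysis is asserted; these are finite block-geometry identities/inequalities.  HONEST (cell):
bookkeeping for row S68 (c) on OUR side of WALL §2 (a); NE7c NOT PRINTED, NOT PROVED; spine PROVED 0/9; rung (B)+1 on a
FINITE T⁴ — NOT infinite volume, NOT mass gap, NOT Clay.  HONEST DEPENDENCY: continuum YM on T⁴ ⇐ BetaPertH ∧ nine spine
estimates (0/9 proved); BetaPertH ⇐ (D1) ∧ (D4) ∧ CAP+tail; G-an2-4 gates asym, D1 and NE2/3/4.
-/

noncomputable section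

open scoped BigOperators
open Finset

namespace Literature.MathematicalPhysics.QuantumFieldTheory.Balaban1983to89.B7Prop5GeneralOperators

open B7Prop1Explicit B7Prop1Local B7Prop3Flat B7Prop4Flat B7Prop5Flat B7Ineq148

export B7Prop1Explicit (Site)

variable {d : ℕ}

/-! ## §1 The one-step operators `L·Q` and `Q″` (139)–(140) on real bond functions -/

/-- **`L·(Qg)_c`**, `c = ⟨q, q + Le_κ⟩`: the un-normalised straight-line block average `Σ_{r∈[0,L)ᵈ} L^{−d} Σ_{i<L}
g(q + r + ie_κ, κ)` of a real bond function ((125), B5 (1.11); the shape of `B7Prop4Flat.linQ_eq_sum`).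
[cite: Balaban1985Averaging, (139) p.39, (125) p.36] -/
def avQ (L : ℕ) (g : Site d → Fin d → ℝ) (q : Site d) (κ : Fin d) : ℝ :=
  ∑ r : Fin d → Fin L, ((L : ℝ) ^ d)⁻¹ * ∑ i : Fin L, g (q + boxVec L r + ((i : ℕ) : ℤ) • e κ) κ

/-- **(140)** «(Q″A)_c = Σ_{b⊂B(c₋)∪B(c₊)} L^{−d}A_b» on a real bond function, the bonds of `B(c₋) ∪ B(c₊)` being
`B7Prop5Flat.S1 L q κ` (both endpoints in `[q, q + (L−1)𝟙 + Le_κ]`). [cite: Balaban1985Averaging, (140) p.39] -/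
def ddQ (L : ℕ) (g : Site d → Fin d → ℝ) (q : Site d) (κ : Fin d) : ℝ :=
  ((L : ℝ) ^ d)⁻¹ * ∑ b ∈ S1 L q κ, g b.1 b.2

/-- `avQ` is monotone (a positive operator). [cite: Balaban1985Averaging, (139) p.39] -/
theorem avQ_mono (L : ℕ) {g g' : Site d → Fin d → ℝ} (h : ∀ x κ, g x κ ≤ g' x κ) (q : Site d) (κ : Fin d) :
    avQ L g q κ ≤ avQ L g' q κ :=
  sum_le_sum fun _ _ => mul_le_mul_of_nonneg_left (sum_le_sum fun _ _ => h _ _) (by positivity)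

/-- `ddQ` is monotone (a positive operator). [cite: Balaban1985Averaging, (140) p.39] -/
theorem ddQ_mono (L : ℕ) {g g' : Site d → Fin d → ℝ} (h : ∀ x κ, g x κ ≤ g' x κ) (q : Site d) (κ : Fin d) :
    ddQ L g q κ ≤ ddQ L g' q κ :=
  mul_le_mul_of_nonneg_left (sum_le_sum fun _ _ => h _ _) (by positivity)

/-- `avQ` of a non-negative function is non-negative (`Q` is a positive operator, (139)). [cite: Balaban1985Averaging, (139) p.39] -/
theorem avQ_nonneg (L : ℕ) {g : Site d → Fin d → ℝ} (h : ∀ x κ, 0 ≤ g x κ) (q : Site d) (κ : Fin d) :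
    0 ≤ avQ L g q κ :=
  sum_nonneg fun _ _ => mul_nonneg (by positivity) (sum_nonneg fun _ _ => h _ _)

/-- `ddQ` of a non-negative function is non-negative (`Q″` is a positive operator, (139)–(140)). [cite: Balaban1985Averaging, (139)–(140) p.39] -/
theorem ddQ_nonneg (L : ℕ) {g : Site d → Fin d → ℝ} (h : ∀ x κ, 0 ≤ g x κ) (q : Site d) (κ : Fin d) :
    0 ≤ ddQ L g q κ :=
  mul_nonneg (by positivity) (sum_nonneg fun _ _ => h _ _)

/-- the operator `Q` of (139) is additive. [cite: Balaban1985Averaging, (139) p.39, (125) p.36] -/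
theorem avQ_add (L : ℕ) (g g' : Site d → Fin d → ℝ) (q : Site d) (κ : Fin d) :
    avQ L (fun x κ => g x κ + g' x κ) q κ = avQ L g q κ + avQ L g' q κ := by
  simp only [avQ, sum_add_distrib, mul_add]

/-- the operator `Q` of (139) is homogeneous. [cite: Balaban1985Averaging, (139) p.39, (125) p.36] -/
theorem avQ_smul (L : ℕ) (c : ℝ) (g : Site d → Fin d → ℝ) (q : Site d) (κ : Fin d) :
    avQ L (fun x κ => c * g x κ) q κ = c * avQ L g q κ := by
  simp only [avQ, mul_sum]
  exact sum_congr rfl fun r _ => sum_congr rfl fun i _ => by ring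

/-- the operator `Q″` of (140) is additive. [cite: Balaban1985Averaging, (140) p.39] -/
theorem ddQ_add (L : ℕ) (g g' : Site d → Fin d → ℝ) (q : Site d) (κ : Fin d) :
    ddQ L (fun x κ => g x κ + g' x κ) q κ = ddQ L g q κ + ddQ L g' q κ := by
  simp only [ddQ, sum_add_distrib, mul_add]

/-- the operator `Q″` of (140) is homogeneous. [cite: Balaban1985Averaging, (140) p.39] -/
theorem ddQ_smul (L : ℕ) (c : ℝ) (g : Site d → Fin d → ℝ) (q : Site d) (κ : Fin d) :
    ddQ L (fun x κ => c * g x κ) q κ = c * ddQ L g q κ := by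
  simp only [ddQ, mul_sum]
  exact sum_congr rfl fun b _ => by ring

/-- pv23's `Qpp` ((140) on the finite product `𝔸^S`) at `S = S1 L q κ` IS `ddQ` of the pointwise norm:
`Qpp L d (restr S E) = ddQ L ‖E‖ q κ`. [cite: Balaban1985Averaging, (140) p.39] -/
theorem Qpp_restr_eq_ddQ {𝔸 : Type*} [NormedRing 𝔸] (L : ℕ) (q : Site d) (κ : Fin d) (E : Site d → Fin d → 𝔸) :
    Qpp (L : ℝ) d (restr (S1 L q κ) E) = ddQ L (fun x κ' => ‖E x κ'‖) q κ := by
  unfold Qpp ddQ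
  rw [← mul_sum]
  congr 1
  exact sum_coe_sort (S1 L q κ) (fun s => ‖E s.1 s.2‖)

/-! ## §2 The kernel columns of `Q_j` and `Q″_j` at a unit-lattice bond `b = ⟨y, y + e_μ⟩` -/

/-- the number of segment positions of the `N`-block average based at `p` in direction `κ` that equal the site `y`:
`#{(r, i) ∈ [0,N)ᵈ × [0,N) : p + r + ie_κ = y}`. [folklore] -/
def hits (N : ℕ) (p : Site d) (κ : Fin d) (y : Site d) : ℕ :=
  ∑ r : Fin d → Fin N, ∑ i : Fin N, if p + boxVec N r + ((i : ℕ) : ℤ) • e κ = y then 1 else 0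

/-- **the column of the un-normalised `Q_j`** («a composition of k operators Q is the operator Q_k», p. 39; B5 (1.18)
`(Q_kA)_b = Σ_{x∈B^k(b₋)} η^{d+1}A([x, x(b)])`): the coefficient of `A_{⟨y, y+e_μ⟩}` in `Σ_{x∈Bʲ(c₋)} L^{−jd} A([x, x + Lʲe_κ])`,
`c = ⟨Lʲz, Lʲz + Lʲe_κ⟩` — zero unless `μ = κ`. [cite: Balaban1985Averaging, p.39 (after (140)); Balaban1984PropagatorsI, (1.18) p.20] -/
def kerQ (L j : ℕ) (z : Site d) (κ : Fin d) (y : Site d) (μ : Fin d) : ℝ :=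
  if μ = κ then (((L : ℝ) ^ j) ^ d)⁻¹ * (hits (L ^ j) (((L : ℤ) ^ j) • z) κ y : ℝ) else 0

open Classical in
/-- **the column of `Q″_j` (141)** «(Q″_kA)_c = Σ_{b⊂B^k(c₋)∪B^k(c₊)} η^dA_b»: `L^{−jd}·𝟙[b ⊂ Bʲ(c₋) ∪ Bʲ(c₊)]`, the box read on
the unit lattice as `[Lʲz, Lʲz + (Lʲ−1)𝟙 + Lʲe_κ]` (`B7Prop5Flat.BondIn (loK L j z) (bondHiK L j z κ)`). [cite: Balaban1985Averaging, (141) p.39] -/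
def kerQdd (L j : ℕ) (z : Site d) (κ : Fin d) (y : Site d) (μ : Fin d) : ℝ :=
  if BondIn (loK L j z) (bondHiK L j z κ) y μ then (((L : ℝ) ^ j) ^ d)⁻¹ else 0

/-- the column of (141) on the box `Bʲ(c₋) ∪ Bʲ(c₊)`: weight `η^d = L^{−jd}`. [cite: Balaban1985Averaging, (141) p.39] -/
theorem kerQdd_of_bondIn {L j : ℕ} {z y : Site d} {κ μ : Fin d} (h : BondIn (loK L j z) (bondHiK L j z κ) y μ) :
    kerQdd L j z κ y μ = (((L : ℝ) ^ j) ^ d)⁻¹ := by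
  classical
  simp [kerQdd, h]

/-- `kerQdd` vanishes off the box (locality of (141)). [cite: Balaban1985Averaging, (141) p.39] -/
theorem kerQdd_of_not_bondIn {L j : ℕ} {z y : Site d} {κ μ : Fin d} (h : ¬ BondIn (loK L j z) (bondHiK L j z κ) y μ) :
    kerQdd L j z κ y μ = 0 := by
  classical
  simp [kerQdd, h]

/-- the column of (141) is non-negative (`Q″_j` is a positive operator, (142)). [cite: Balaban1985Averaging, (141)–(142) p.39] -/
theorem kerQdd_nonneg (L j : ℕ) (z : Site d) (κ : Fin d) (y : Site d) (μ : Fin d) : 0 ≤ kerQdd L j z κ y μ := by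
  classical
  unfold kerQdd; split_ifs <;> positivity

/-- the column of (141) is at most its weight `η^d = L^{−jd}`. [cite: Balaban1985Averaging, (141) p.39] -/
theorem kerQdd_le (L j : ℕ) (z : Site d) (κ : Fin d) (y : Site d) (μ : Fin d) :
    kerQdd L j z κ y μ ≤ (((L : ℝ) ^ j) ^ d)⁻¹ := by
  classical
  unfold kerQdd; split_ifs
  · exact le_rfl
  · positivity

/-- the column of `Q_j` is non-negative (`Q_j` is a positive operator, (143)). [cite: Balaban1985Averaging, p.39 (after (140)), (143) p.39] -/
theorem kerQ_nonneg (L j : ℕ) (z : Site d) (κ : Fin d) (y : Site d) (μ : Fin d) : 0 ≤ kerQ L j z κ y μ := by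
  unfold kerQ; split_ifs <;> positivity

/-- `hits` as the cardinality of the set of segment positions equal to `y`. [folklore] -/
private theorem hits_eq_card (N : ℕ) (p : Site d) (κ : Fin d) (y : Site d) :
    hits N p κ y = (Finset.univ.filter fun ri : (Fin d → Fin N) × Fin N =>
      p + boxVec N ri.1 + ((ri.2 : ℕ) : ℤ) • e κ = y).card := by
  classical
  rw [hits, card_filter, Fintype.sum_prod_type]

/-- AT MOST `N` segment positions of one block average equal a given site (one per position `i` on the segment: `i`
determines `r`) — the count behind (147) «|Q_k(U₀; c, b)| ≦ 1 + 2C′₁α₀» at `α₀ = 0` (the kernel of the straight-line average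
`Q_k` is `≤ η^d` per bond; `B7Prop5Flat.norm_linQIter_bump_le`). [cite: Balaban1985Averaging, (147) p.40; Balaban1984PropagatorsI, (1.18) p.20] -/
theorem hits_le (N : ℕ) (p : Site d) (κ : Fin d) (y : Site d) : hits N p κ y ≤ N := by
  classical
  rw [hits_eq_card]
  have hinj : Set.InjOn (fun ri : (Fin d → Fin N) × Fin N => ri.2)
      (Finset.univ.filter fun ri : (Fin d → Fin N) × Fin N => p + boxVec N ri.1 + ((ri.2 : ℕ) : ℤ) • e κ = y) := by
    intro ri hri ri' hri' h2
    simp only [coe_filter, mem_univ, true_and, Set.mem_setOf_eq] at hri hri'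
    simp only at h2
    have hb : boxVec N ri.1 = boxVec N ri'.1 := by
      have := hri.trans hri'.symm
      rw [h2] at this
      exact add_left_cancel (add_right_cancel this)
    refine Prod.ext (funext fun ν => Fin.ext ?_) h2
    have := congrFun hb ν
    simpa [boxVec] using this
  have h := card_le_card_of_injOn _ (fun ri _ => mem_coe.2 (mem_univ ri.2)) hinj
  simpa using h

/-- a segment position equal to `y` puts the bond `⟨y, y + e_κ⟩` inside `Bʲ(c₋) ∪ Bʲ(c₊)` (`bondIn_pow_line`) — the locality
«depends only on the bond variables U_b for b ⊂ B^k(c₋) ∪ B^k(c₊)» of the straight-line average. [cite: Balaban1985Averaging, p.24 (after (43)), (141) p.39] -/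
theorem bondIn_of_hits_ne_zero {L j : ℕ} {z y : Site d} {κ : Fin d} (h : hits (L ^ j) (((L : ℤ) ^ j) • z) κ y ≠ 0) :
    BondIn (loK L j z) (bondHiK L j z κ) y κ := by
  classical
  rw [hits_eq_card] at h
  obtain ⟨ri, hri⟩ := card_ne_zero.1 h
  simp only [mem_filter, mem_univ, true_and] at hri
  have hP : ((L ^ j : ℕ) : ℤ) = (L : ℤ) ^ j := by push_cast; rfl
  rw [← hri, ← hP]
  exact bondIn_pow_line L j z κ ri.1 ri.2

/-- `kerQ` vanishes off the box and across directions (locality of the straight-line average). [cite: Balaban1985Averaging, p.24 (after (43)), p.39] -/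
theorem kerQ_of_not_bondIn {L j : ℕ} {z y : Site d} {κ μ : Fin d} (h : ¬ BondIn (loK L j z) (bondHiK L j z κ) y μ) :
    kerQ L j z κ y μ = 0 := by
  unfold kerQ
  split_ifs with hμ
  · subst hμ
    by_cases h0 : hits (L ^ j) (((L : ℤ) ^ j) • z) μ y = 0
    · rw [h0]; simp
    · exact absurd (bondIn_of_hits_ne_zero h0) h
  · rfl

/-- **«Q_k|A| ≦ Q″_k|A|» PER COLUMN** (the step to (146), p. 40: every segment bond of the `Lʲ`-block average at `c` lies in
`Bʲ(c₋) ∪ Bʲ(c₊)` and is met at most `Lʲ` times with weight `L^{−jd}`), un-normalised: `kerQ ≤ Lʲ·kerQdd`.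
[cite: Balaban1985Averaging, (146) p.40] -/
theorem kerQ_le (L j : ℕ) (z : Site d) (κ : Fin d) (y : Site d) (μ : Fin d) :
    kerQ L j z κ y μ ≤ (L : ℝ) ^ j * kerQdd L j z κ y μ := by
  unfold kerQ
  split_ifs with hμ
  · subst hμ
    by_cases h0 : hits (L ^ j) (((L : ℤ) ^ j) • z) μ y = 0
    · rw [h0]; simpa using mul_nonneg (by positivity : (0 : ℝ) ≤ (L : ℝ) ^ j) (kerQdd_nonneg L j z μ y μ)
    · rw [kerQdd_of_bondIn (bondIn_of_hits_ne_zero h0), mul_comm ((L : ℝ) ^ j)]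
      refine mul_le_mul_of_nonneg_left ?_ (by positivity)
      have h := hits_le (L ^ j) (((L : ℤ) ^ j) • z) μ y
      exact_mod_cast h
  · exact mul_nonneg (by positivity) (kerQdd_nonneg L j z κ y μ)

/-- the level-0 column: `Q_0(U₀) = 1` («Q_0(U₀, ηA) = ηA», the empty composition (127)), `kerQ L 0 z κ y μ = 𝟙[(z, κ) = (y, μ)]`.
[cite: Balaban1985Averaging, (127) p.37] -/
theorem kerQ_zero (L : ℕ) (z : Site d) (κ : Fin d) (y : Site d) (μ : Fin d) :
    kerQ L 0 z κ y μ = if z = y ∧ κ = μ then 1 else 0 := by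
  unfold kerQ
  simp only [pow_zero, one_pow, inv_one, one_mul, one_smul]
  have h0 : ∀ r : Fin d → Fin 1, boxVec 1 r = 0 := fun r => funext fun ν => by simp [boxVec]
  have hh : hits 1 z κ y = if z = y then 1 else 0 := by
    unfold hits
    rw [Fintype.sum_unique, Fintype.sum_unique]
    simp [h0]
  rw [hh]
  by_cases hz : z = y <;> by_cases hκ : κ = μ <;> simp [hz, hκ, eq_comm]

/-- **DICTIONARY WITH b07's FLAT OBJECTS**: the un-normalised composed linear part `Q_j(1)` of `B7Prop4Flat` in the
single-bond direction IS the kernel column: `linQIter L (X·δ_b) j (c) = kerQ(c, b)·X`. [cite: Balaban1985Averaging, (127) p.37, (147) p.40] -/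
theorem linQIter_bump {𝔸 : Type*} [NormedRing 𝔸] [NormedAlgebra ℂ 𝔸] (L j : ℕ) (y : Site d) (μ : Fin d) (X : 𝔸)
    (z : Site d) (κ : Fin d) : linQIter L (bump y μ X) j z κ = kerQ L j z κ y μ • X := by
  classical
  rw [linQIter_eq_linQ_pow, linQ_eq_sum, kerQ, hits]
  have hN : ((L ^ j : ℕ) : ℝ) = (L : ℝ) ^ j := by push_cast; rfl
  have hP : ((L ^ j : ℕ) : ℤ) • z = ((L : ℤ) ^ j) • z := by push_cast; rfl
  rw [hP]
  by_cases hμ : μ = κ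
  · subst hμ
    simp only [if_true, Nat.cast_sum, Nat.cast_ite, Nat.cast_one, Nat.cast_zero, mul_sum, sum_smul]
    refine sum_congr rfl fun r _ => ?_
    rw [hN, smul_sum]
    refine sum_congr rfl fun i _ => ?_
    simp only [bump, and_true]
    split_ifs <;> simp
  · rw [if_neg hμ, zero_smul]
    refine sum_eq_zero fun r _ => ?_
    rw [sum_eq_zero fun i _ => ?_, smul_zero]
    exact bump_eq_zero_of X fun hh => hμ hh.2.symm

end Literature.MathematicalPhysics.QuantumFieldTheory.Balaban1983to89.B7Prop5GeneralOperators

end
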